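import Literature.AlgebraicGeometry.HodgeTheory.VHSDataChartedTensorConstructions
import Literature.AlgebraicGeometry.HodgeTheory.VHSDataDeterminationLocusOverCurve
import Mathlib.Analysis.Complex.Convex
import Mathlib.Analysis.Convex.PathConnected
import Mathlib.Topology.Connected.LocallyPathConnected
import HarnessLib

/-!
# Flat local period charts, and Cattani–Deligne–Kaplan's Corollary 1.3 (`r = 1`) for every tensor construction
# `D₁ ⊗ D₂`, `D^∨`, `D(j)`, `D^{⊗m}`, `T^{a,b}D = D^{⊗a} ⊗ (D^∨)^{⊗b}`, `Hom(D₁, D₂)` from flat charts of the factors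

Topic `Literature/AlgebraicGeometry/HodgeTheory` (namespaces `Literature.AlgebraicGeometry.Motives.VHSData[.InteriorChart ∕ .PunctureChart ∕
.IsFlatCharted]`, `Literature.AlgebraicGeometry.HodgeTheory` for the topological lemmas), lane `lit-hodgefound` (seat `p08`, row g59-#1); the
companion of `VHSDataChartedTensorConstructions` (`IsCharted`: CDK Thm 1.1 ∕ Cor 1.2 for the NORM-BOUNDED loci `hodgeLocusOfNormLe` of all tensor
constructions) and of `VHSDataDeterminationLocusOverCurve` (Cor 1.3 for ONE multivalued flat class, from charts given as loose hypotheses with a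
FLATNESS clause).  THREE DEFINITIONS WITH BODIES, all `Prop`-valued predicates — `InteriorChart.IsFlat`, `PunctureChart.IsFlat`, `IsFlatCharted` —
and THEOREMS; no named fact, no instance, no notation (D-0026 net debt `0`).

PRINTED SOURCE, VERBATIM (E. Cattani, P. Deligne, A. Kaplan, *On the locus of Hodge classes*, J. Amer. Math. Soc. 8 (1995), p. 484).
«**Corollary 1.3.** Let `u` be a section of the local system `𝒱_ℤ` on a universal covering of `S`. The set of points in `S` where some
determination of `u` is of type `(0, 0)` is an algebraic subvariety of `S`.  *Proof.* Such a set is a union of images of connected components of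
`S^{(K)}`, for `K = Q(u, u)`.»  (2.4) (p. 488): «on `ℋ^r`, the pullback of the local system `𝒱_ℤ` can be trivialized».  W. Schmid, *Variation of
Hodge structure*, Invent. Math. 22 (1973), §2: over a simply connected base a flat bundle is trivialized by its flat sections, and parallel
transport along any path is the identity in such a frame.

`VHSData` READING.  A determination of `u₀ ∈ V_ℤ,s₀` at `t` is `γ · u₀` for a path class `γ : s₀ ⇝ t` (`LocalSystem.transport`); the set of the
corollary is `{t | ∃ γ, γ · u₀ is of type (p, p) at t}`.  The charts of `VHSDataInteriorChart` ∕ `VHSDataPunctureChart` record trivializations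
`e_c : V_{ψ⁻¹(c)} ⥲ V`, `e_z : V_{σ(z)} ⥲ V` fibre by fibre; that they come from FLAT FRAMES is the extra clause FLATNESS: parallel transport along
every path INSIDE the coordinate disc (resp. along `σ ∘ γ̃` for every path `γ̃` in the half-plane `{Im ≥ A₀}`) reads as the identity,
`e_{c′}(γ · y) = e_c(y)`.  Quantifying over ALL in-chart paths (not over one chosen path per pair of points) is what is true of flat frames and what
makes flatness stable under `⊗` (both factors are flat along the SAME path).

CONTENT.
* §0 topology: in-disc paths between two points of a coordinate disc with preconnected target (`exists_path_forall_mem_source`: open preconnected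
  subsets of `ℂ` are path connected); paths `σ ∘ γ̃` in the half-planes (`exists_path_eq_comp_of_continuousOn`, convexity); **the end lifts `σ i` of a
  punctured compact curve are continuous on `{Im z > A₀ i}`** (`continuousOn_end_lift`: `j ∘ σ = φ⁻¹ ∘ e^{2πi·}` with `j` an embedding).
* §1 **`InteriorChart.IsFlat`**, **`PunctureChart.IsFlat`**; the loose `∃ δ` flatness clauses of `VHSDataDeterminationLocusOverCurve` follow
  (`IsFlat.exists_transport_eq`); `raise`.
* §2 flatness under the constructions: **`IsFlat.tensor`** (`(e₁ ⊗ e₂)_{c′}((γ·)⊗(γ·)) = (e₁ ⊗ e₂)_c`), **`IsFlat.dual`** (the polarization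
  isomorphisms `θ_s = Q_s♭` commute with transport since `Q` is flat: `ofDualFiber_dual_transport`), `cast`, `tateTwist`, and the flat charts of the
  constant variations `const ∕ tate ∕ unit` (transport `= id`).
* §3 **`IsFlatCharted D ψ σ`** (flat interior charts on the discs `ψ a`, flat puncture charts along the ends `σ i`, reference data existential in
  `Type`), `IsFlatCharted.isCharted`, closure under `tensor ∕ cast ∕ tateTwist ∕ dual ∕ const ∕ tate ∕ unit ∕ tensorPow ∕ tensorSpace ∕ hom`.
* §4 the local dichotomies from flat bundled charts: `IsFlat.mem_nhds_or_eventually_not_mem_determinationLocus` (interior),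
  `IsFlat.exists_forall_mem_determinationLocus_or_forall_not_mem` (puncture, given continuity of `σ` on an open half-plane).
* §5 **`IsFlatCharted.determinationLocus_eq_univ_or_finite`** — COR. 1.3 (`r = 1`) for a flat-charted `D` over a preconnected `S` covered by the
  discs, with open ends, a compact core and continuous end maps — and `…_of_compactification` (punctured compact curve: all three topological
  hypotheses read off the compactification).
* §6 **COR. 1.3 FOR ALL TENSOR CONSTRUCTIONS**: `determinationLocus_tensor_eq_univ_or_finite`, `…_dual_…`, `…_tensorPow_…`,
  **`determinationLocus_tensorSpace_eq_univ_or_finite(_of_compactification)`**, **`determinationLocus_hom_eq_univ_or_finite`** — for a multivalued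
  flat integral tensor `u₀ ∈ T^{a,b}V_ℤ,s₀` (resp. `u₀ ∈ Hom(V₁,ℤ, V₂,ℤ)_{s₀}`), the set of points of the curve where SOME determination of `u₀` is
  of type `(p, p)` is all of `S` or finite.

HONEST SCOPE.  `IsFlat` ∕ `IsFlatCharted` are HYPOTHESES on the datum (`VHSData` records neither holomorphy nor Griffiths transversality); for an
honest polarized `ℤ`VHS over a curve with unipotent local monodromies, flat charts exist on simply connected coordinate discs and along the ends by
Schmid's nilpotent orbit theorem and the triviality of local systems on simply connected spaces — cited, not constructed.  Not here: the
identification of the set of Cor. 1.3 with a union of images of components of `S^{(K)}` as analytic spaces; bases of dimension `≥ 2`; `r ≥ 2`.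

## References

* [CattaniDeligneKaplan1995] E. Cattani, P. Deligne, A. Kaplan, *On the locus of Hodge classes*, J. Amer. Math. Soc. 8 (1995) 483–506: §1 (pp. 483–484),
  Thm. 1.1, Cor. 1.2, Cor. 1.3 (p. 484), Thm. 1.5 and «Proof of 1.5 ⟹ 1.1» (p. 485), 2.3 (p. 487), (2.4) (p. 488), 2.7 (p. 489).
* [Schmid1973] W. Schmid, *Variation of Hodge structure: the singularities of the period mapping*, Invent. Math. 22 (1973), §2 (flat trivializations
  over simply connected bases; variations are stable under `⊗`, duals), (4.9)–(4.12) (cite only).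
* [Deligne1970] P. Deligne, *Équations différentielles à points singuliers réguliers*, LNM 163 (1970), I.1 (local systems, `⊗`, `Hom = dual ⊗`).
* [Deligne1982HodgeCycles] P. Deligne, *Hodge cycles on abelian varieties*, LNM 900 (1982), I §3, 3.1–3.4 (the tensor spaces `T^{a,b}`), Prop. 3.6.
* [DeligneHodgeII1971] P. Deligne, *Théorie de Hodge II*, Publ. Math. IHÉS 40 (1971), 1.1.12, 2.1.13–2.1.15.
* [FritzscheGrauert2002] K. Fritzsche, H. Grauert, *From Holomorphic Functions to Complex Manifolds*, GTM 213 (2002), Ch. I §8.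
* [KlinglerOtwinowskaUrbanik2023] B. Klingler, A. Otwinowska, D. Urbanik, *On the fields of definition of Hodge loci*, Ann. Sci. ÉNS 56 (2023), §1.1
  (the tensorial Hodge locus; context only).
-/

noncomputable section

open scoped TensorProduct
open _root_.Topology _root_.Filter Set

universe u

/-! ## §0 Topology: in-disc paths, paths along an end, continuity of the end lifts -/

namespace Literature.AlgebraicGeometry.HodgeTheory

variable {S : Type*} [TopologicalSpace S]

/-- **Two points of a coordinate disc with preconnected target are joined by a path INSIDE the disc**: an open preconnected subset of `ℂ` is path
connected (locally path connected space), and `ψ⁻¹` maps a path in the target to a path in the source. [cite: FritzscheGrauert2002, Ch. I §8] -/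
theorem exists_path_forall_mem_source (ψ : OpenPartialHomeomorph S ℂ) (hψ : IsPreconnected ψ.target) {c c' : ℂ} (hc : c ∈ ψ.target)
    (hc' : c' ∈ ψ.target) : ∃ γ : Path (ψ.symm c) (ψ.symm c'), ∀ t, γ t ∈ ψ.source := by
  have hpc : IsPathConnected ψ.target := ψ.open_target.isConnected_iff_isPathConnected.1 ⟨⟨c, hc⟩, hψ⟩
  obtain ⟨γ₀, hγ₀⟩ := hpc.joinedIn c hc c' hc'
  have hcont : Continuous fun t => ψ.symm (γ₀ t) := ψ.continuousOn_symm.comp_continuous γ₀.continuous hγ₀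
  exact ⟨⟨⟨fun t => ψ.symm (γ₀ t), hcont⟩, by simp, by simp⟩, fun t => ψ.map_target (hγ₀ t)⟩

/-- **Two points `σ z`, `σ z′` of an end, `Im z, Im z′ ≥ A`, are joined by a path `σ ∘ γ̃` with `γ̃` in the closed half-plane `{Im ≥ A}`** when `σ` is
continuous there (the half-plane is convex). [cite: CattaniDeligneKaplan1995, 2.3 (p. 487)] -/
theorem exists_path_eq_comp_of_continuousOn {σ : ℂ → S} {A : ℝ} (hσ : ContinuousOn σ {w : ℂ | A ≤ w.im}) {z z' : ℂ} (hz : A ≤ z.im)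
    (hz' : A ≤ z'.im) : ∃ (γ' : Path z z') (γ : Path (σ z) (σ z')), (∀ t, A ≤ (γ' t).im) ∧ ∀ t, γ t = σ (γ' t) := by
  obtain ⟨γ₀, hγ₀⟩ := ((convex_halfSpace_im_ge A).isPathConnected ⟨z, hz⟩).joinedIn z hz z' hz'
  have hcont : Continuous fun t => σ (γ₀ t) := hσ.comp_continuous γ₀.continuous hγ₀
  exact ⟨γ₀, ⟨⟨fun t => σ (γ₀ t), hcont⟩, by simp, by simp⟩, hγ₀, fun _ => rfl⟩

variable {X : Type*} [TopologicalSpace X]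

/-- **The end lifts of a punctured compact curve are continuous on the open half-planes**: if `j : S → X` is an embedding, `φ` a chart of `X` whose
target contains the disc of radius `e^{−2πA₀}` and `j (σ z) = φ⁻¹(e^{2πiz})` for `Im z > A₀`, then `σ` is continuous on `{Im z > A₀}`.
[cite: CattaniDeligneKaplan1995, 2.3 (p. 487)] -/
theorem continuousOn_end_lift {j : S → X} (hj : IsEmbedding j) (φ : OpenPartialHomeomorph X ℂ) {A₀ : ℝ}
    (hball : Metric.ball (0 : ℂ) (Real.exp (-(2 * Real.pi * A₀))) ⊆ φ.target) {σ : ℂ → S}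
    (hσ : ∀ z : ℂ, A₀ < z.im → j (σ z) = φ.symm (Complex.exp (2 * Real.pi * Complex.I * z))) :
    ContinuousOn σ {z : ℂ | A₀ < z.im} := by
  rw [hj.continuousOn_iff]
  have hexp : Continuous fun z : ℂ => Complex.exp (2 * Real.pi * Complex.I * z) := by fun_prop
  have h : ContinuousOn (fun z : ℂ => φ.symm (Complex.exp (2 * Real.pi * Complex.I * z))) {z : ℂ | A₀ < z.im} :=
    φ.continuousOn_symm.comp hexp.continuousOn fun z hz => hball ((Literature.Topology.exp_two_pi_I_mul_mem_ball_iff z A₀).2 hz)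
  exact h.congr fun z hz => hσ z hz

/-- The family form: all the end lifts `σ i` are continuous on `{Im z > A₀ i}`. [cite: CattaniDeligneKaplan1995, 2.3 (p. 487)] -/
theorem continuousOn_end_lifts {ι : Type*} {j : S → X} (hj : IsEmbedding j) (φ : ι → OpenPartialHomeomorph X ℂ) (A₀ : ι → ℝ)
    (hball : ∀ i, Metric.ball (0 : ℂ) (Real.exp (-(2 * Real.pi * A₀ i))) ⊆ (φ i).target) (σ : ι → ℂ → S)
    (hσ : ∀ (i : ι) (z : ℂ), A₀ i < z.im → j (σ i z) = (φ i).symm (Complex.exp (2 * Real.pi * Complex.I * z))) (i : ι) :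
    ContinuousOn (σ i) {z : ℂ | A₀ i < z.im} :=
  continuousOn_end_lift hj (φ i) (hball i) (hσ i)

end Literature.AlgebraicGeometry.HodgeTheory

namespace Literature.AlgebraicGeometry

open Module
open Motives Motives.MixedHodgeStructure Motives.HodgeStructure
open Motives.HodgeStructure (conj ofRat ofRat_apply conj_ofRat)
open HodgeTheory

namespace Motives.VHSData

variable {S : Type} [TopologicalSpace S] {k k' k₁ k₂ : ℤ}

/-! ## §1 Flat charts -/

section Flat

variable {D : VHSData S k} {V : Type u} [AddCommGroup V] [Module ℚ V] [FiniteDimensional ℚ V]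

namespace InteriorChart

variable {ψ : OpenPartialHomeomorph S ℂ} {H₀ : HodgeStructure V k} {P₀ : H₀.Polarization}

/-- **The interior chart `C` is FLAT**: its trivializations `e_c : V_{ψ⁻¹(c)} ⥲ V` (`c ∈ ψ.target`) form a flat frame over the coordinate disc —
parallel transport along EVERY path inside `ψ.source` reads as the identity, `e_{c′}(γ · y) = e_c(y)` (as for the frame of flat sections of
`𝒱|_U` over a simply connected coordinate disc `U`). [cite: Schmid1973, §2] [cite: CattaniDeligneKaplan1995, §1 (p. 484) and (2.4) (p. 488)] -/
def IsFlat (C : D.InteriorChart ψ P₀) : Prop :=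
  ∀ ⦃c c' : ℂ⦄, c ∈ ψ.target → c' ∈ ψ.target → ∀ γ : Path (ψ.symm c) (ψ.symm c'), (∀ t, γ t ∈ ψ.source) →
    ∀ y : D.V.fiber (ψ.symm c), C.e c' (D.V.transport (Path.Homotopic.Quotient.mk γ) y) = C.e c y

variable {C : D.InteriorChart ψ P₀}

omit [FiniteDimensional ℚ V] in
/-- **A flat interior chart has the loose flatness clause of `VHSDataDeterminationLocusOverCurve`**: any two points of the disc are joined by a path
class `δ` with `e_{c′}(δ · y) = e_c(y)` (a path inside the disc, `exists_path_forall_mem_source`). [cite: Schmid1973, §2] -/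
theorem IsFlat.exists_transport_eq (hC : C.IsFlat) {c : ℂ} (hc : c ∈ ψ.target) {c' : ℂ} (hc' : c' ∈ ψ.target) :
    ∃ δ : Path.Homotopic.Quotient (ψ.symm c) (ψ.symm c'), ∀ y : D.V.fiber (ψ.symm c), C.e c' (D.V.transport δ y) = C.e c y := by
  obtain ⟨γ, hγ⟩ := exists_path_forall_mem_source ψ C.isPreconnected_target hc hc'
  exact ⟨Path.Homotopic.Quotient.mk γ, hC hc hc' γ hγ⟩

omit [FiniteDimensional ℚ V] in
/-- On integral vectors: `e_{c′}(toRat (γ · u)) = e_c(toRat u)` along in-disc paths. [cite: Schmid1973, §2] -/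
theorem IsFlat.apply_toRat_transport (hC : C.IsFlat) {c c' : ℂ} (hc : c ∈ ψ.target) (hc' : c' ∈ ψ.target) (γ : Path (ψ.symm c) (ψ.symm c'))
    (hγ : ∀ t, γ t ∈ ψ.source) (u : D.VZ.fiber (ψ.symm c)) :
    C.e c' (D.toRat (ψ.symm c') (D.VZ.transport (Path.Homotopic.Quotient.mk γ) u)) = C.e c (D.toRat (ψ.symm c) u) := by
  rw [← D.transport_toRat, hC hc hc' γ hγ]

end InteriorChart

namespace PunctureChart

variable {σ : ℂ → S} {L : PolarizedLimitMixedHodgeStructure V k}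

/-- **The puncture chart `C` is FLAT**: its trivializations `e_z : V_{σ(z)} ⥲ V` (`Im z ≥ A₀`) form a flat frame of the pull-back of `𝒱` to the
half-plane — parallel transport along `σ ∘ γ̃`, for EVERY path `γ̃` inside `{Im ≥ A₀}`, reads as the identity, `e_{z′}((σ ∘ γ̃) · y) = e_z(y)` («on `ℋ`,
the pullback of the local system `𝒱_ℤ` can be trivialized»).  Paths in `S` that merely stay in the punctured neighbourhood `σ{Im ≥ A₀}` are NOT
asked to be trivial (a loop around the puncture acts by the monodromy `T`). [cite: CattaniDeligneKaplan1995, (2.4) (p. 488)] [cite: Schmid1973, §2] -/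
def IsFlat (C : D.PunctureChart σ L) : Prop :=
  ∀ ⦃z z' : ℂ⦄ (γ' : Path z z') (γ : Path (σ z) (σ z')), (∀ t, C.A₀ ≤ (γ' t).im) → (∀ t, γ t = σ (γ' t)) →
    ∀ y : D.V.fiber (σ z), C.e z' (D.V.transport (Path.Homotopic.Quotient.mk γ) y) = C.e z y

variable {C : D.PunctureChart σ L}

/-- Flatness passes to the chart raised to a greater height (fewer paths). [cite: CattaniDeligneKaplan1995, (2.4) (p. 488)] -/
theorem IsFlat.raise (hC : C.IsFlat) (A : ℝ) (hA : C.A₀ ≤ A) : (C.raise A hA).IsFlat :=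
  fun _ _ γ' γ hγ' hγ y => hC γ' γ (fun t => hA.trans (hγ' t)) hγ y

/-- **A flat puncture chart has the loose flatness clause of `VHSDataDeterminationLocusOverCurve`** as soon as `σ` is continuous on `{Im ≥ A₀}`:
`σ z`, `σ z′` (`Im ≥ A₀`) are joined by a path class `δ` with `e_{z′}(δ · y) = e_z(y)` (the image of the segment). [cite: CattaniDeligneKaplan1995, (2.4) (p. 488)] -/
theorem IsFlat.exists_transport_eq (hC : C.IsFlat) (hσ : ContinuousOn σ {w : ℂ | C.A₀ ≤ w.im}) {z z' : ℂ} (hz : C.A₀ ≤ z.im)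
    (hz' : C.A₀ ≤ z'.im) : ∃ δ : Path.Homotopic.Quotient (σ z) (σ z'), ∀ y : D.V.fiber (σ z), C.e z' (D.V.transport δ y) = C.e z y := by
  obtain ⟨γ', γ, hγ', hγ⟩ := exists_path_eq_comp_of_continuousOn hσ hz hz'
  exact ⟨Path.Homotopic.Quotient.mk γ, hC γ' γ hγ' hγ⟩

end PunctureChart

end Flat

/-! ## §2 Flatness is stable under the tensor constructions -/

section Constructions

variable {V : Type u} [AddCommGroup V] [Module ℚ V] [FiniteDimensional ℚ V]

/-- **The polarization isomorphisms `θ_s⁻¹ : V_s^∨ ⥲ V_s` commute with parallel transport** (`Q` is flat): `θ_t⁻¹(γ · φ) = γ · θ_s⁻¹(φ)`, where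
`γ · φ = φ ∘ γ⁻¹` is the transport of the dual local system. [cite: Schmid1973, §2] [cite: Deligne1970, I.1] -/
theorem ofDualFiber_dual_transport (D : VHSData S k) {s t : S} (γ : Path.Homotopic.Quotient s t) (φ : Module.Dual ℚ (D.V.fiber s)) :
    D.ofDualFiber t (D.dual.V.transport γ φ) = D.V.transport γ (D.ofDualFiber s φ) := by
  haveI : Module.Finite ℚ (D.V.fiber t) := D.finite_fiber t
  apply (D.form t).toDualEquiv.injective
  refine LinearMap.ext fun w => ?_
  rw [HodgeStructure.Polarization.toDualEquiv_apply, HodgeStructure.Polarization.toDualEquiv_apply, D.form_ofDualFiber_apply,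
    D.dual_V_transport_apply, LinearMap.comp_apply]
  conv_rhs => rw [← D.V.transport_apply_transport_symm γ w, D.transport_form s t γ, D.form_ofDualFiber_apply]

namespace InteriorChart

variable {ψ : OpenPartialHomeomorph S ℂ}

section Tensor

variable {D₁ : VHSData S k₁} {D₂ : VHSData S k₂}
variable {V₁ V₂ : Type} [AddCommGroup V₁] [Module ℚ V₁] [FiniteDimensional ℚ V₁] [AddCommGroup V₂] [Module ℚ V₂] [FiniteDimensional ℚ V₂]

omit [FiniteDimensional ℚ V₁] [FiniteDimensional ℚ V₂] in
/-- **`e₁ ⊗ e₂` is flat along a path class along which `e₁` and `e₂` are**: `(e₁′ ⊗ e₂′)((γ·) ⊗ (γ·))(w) = (e₁ ⊗ e₂)(w)` on the fibre of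
`D₁ ⊗ D₂`. [cite: Deligne1970, I.1] [cite: Schmid1973, §2] -/
theorem tensorTriv_transport_eq_of_apply_transport_eq {s t : S} (e₁ : D₁.V.fiber s ≃ₗ[ℚ] V₁) (e₁' : D₁.V.fiber t ≃ₗ[ℚ] V₁)
    (e₂ : D₂.V.fiber s ≃ₗ[ℚ] V₂) (e₂' : D₂.V.fiber t ≃ₗ[ℚ] V₂) (γ : Path.Homotopic.Quotient s t)
    (h₁ : ∀ x : D₁.V.fiber s, e₁' (D₁.V.transport γ x) = e₁ x) (h₂ : ∀ y : D₂.V.fiber s, e₂' (D₂.V.transport γ y) = e₂ y)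
    (w : (D₁.tensor D₂).V.fiber s) :
    tensorTriv D₁ D₂ e₁' e₂' ((D₁.tensor D₂).V.transport γ w) = tensorTriv D₁ D₂ e₁ e₂ w := by
  have h : (TensorProduct.congr e₁' e₂' : D₁.V.fiber t ⊗[ℚ] D₂.V.fiber t →ₗ[ℚ] V₁ ⊗[ℚ] V₂) ∘ₗ
        TensorProduct.map (D₁.V.transport γ) (D₂.V.transport γ) =
      (TensorProduct.congr e₁ e₂ : D₁.V.fiber s ⊗[ℚ] D₂.V.fiber s →ₗ[ℚ] V₁ ⊗[ℚ] V₂) :=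
    TensorProduct.ext' fun x y => by
      simp only [LinearMap.comp_apply, TensorProduct.map_tmul, LinearEquiv.coe_coe, TensorProduct.congr_tmul, h₁, h₂]
  exact LinearMap.congr_fun h w

variable {H₀₁ : HodgeStructure V₁ k₁} {H₀₂ : HodgeStructure V₂ k₂} {P₀₁ : H₀₁.Polarization} {P₀₂ : H₀₂.Polarization}
variable [HodgeTensorFacts.{0, 0}] {C₁ : D₁.InteriorChart ψ P₀₁} {C₂ : D₂.InteriorChart ψ P₀₂}

/-- **Flat interior charts of `D₁`, `D₂` on the same disc give a flat interior chart of `D₁ ⊗ D₂`** (`InteriorChart.tensor`: both factors are flat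
along the same in-disc path). [cite: Schmid1973, §2] [cite: CattaniDeligneKaplan1995, §1 (pp. 483–484)] -/
theorem IsFlat.tensor (h₁ : C₁.IsFlat) (h₂ : C₂.IsFlat) : (C₁.tensor C₂).IsFlat :=
  fun _ _ hc hc' γ hγ w =>
    tensorTriv_transport_eq_of_apply_transport_eq (C₁.e _) (C₁.e _) (C₂.e _) (C₂.e _) _ (h₁ hc hc' γ hγ) (h₂ hc hc' γ hγ) w

end Tensor

variable {D : VHSData S k} {H₀ : HodgeStructure V k} {P₀ : H₀.Polarization} {C : D.InteriorChart ψ P₀}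

omit [FiniteDimensional ℚ V] in
/-- `cast` keeps flatness (same trivializations, same transports). [cite: Schmid1973, §2] -/
theorem IsFlat.cast (hC : C.IsFlat) (h : k = k') : (C.cast h).IsFlat := by
  subst h
  exact hC

omit [FiniteDimensional ℚ V] in
/-- Tate twists keep flatness (same trivializations, same transports). [cite: Schmid1973, §2] [cite: DeligneHodgeII1971, 2.1.14] -/
theorem IsFlat.tateTwist (hC : C.IsFlat) (j : ℤ) : (C.tateTwist j).IsFlat :=
  hC

omit [FiniteDimensional ℚ V] in
/-- **The interior chart of the dual variation is flat when the chart is**: `e_c^∨ = e_c ∘ θ⁻¹` and `θ⁻¹` commutes with transport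
(`ofDualFiber_dual_transport`). [cite: Schmid1973, §2] [cite: Deligne1982HodgeCycles, I Prop. 3.6 (proof)] -/
theorem IsFlat.dual (hC : C.IsFlat) : C.dual.IsFlat := by
  intro c c' hc hc' γ hγ φ
  show D.dualTriv (ψ.symm c') (C.e c') (D.dual.V.transport (Path.Homotopic.Quotient.mk γ) φ) = D.dualTriv (ψ.symm c) (C.e c) φ
  rw [D.dualTriv_apply, D.dualTriv_apply, D.ofDualFiber_dual_transport, hC hc hc' γ hγ]

end InteriorChart

namespace PunctureChart

variable {σ : ℂ → S}

section Tensor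

variable {D₁ : VHSData S k₁} {D₂ : VHSData S k₂}
variable {V₁ V₂ : Type} [AddCommGroup V₁] [Module ℚ V₁] [FiniteDimensional ℚ V₁] [AddCommGroup V₂] [Module ℚ V₂] [FiniteDimensional ℚ V₂]
variable {L₁ : PolarizedLimitMixedHodgeStructure V₁ k₁} {L₂ : PolarizedLimitMixedHodgeStructure V₂ k₂}
variable {C₁ : D₁.PunctureChart σ L₁} {C₂ : D₂.PunctureChart σ L₂}

/-- **Flat puncture charts of `D₁`, `D₂` along the same end give a flat puncture chart of `D₁ ⊗ D₂`** (`PunctureChart.tensor`, height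
`max A₀₁ A₀₂`). [cite: Schmid1973, §2] [cite: CattaniDeligneKaplan1995, (2.4) (p. 488)] -/
theorem IsFlat.tensor (h₁ : C₁.IsFlat) (h₂ : C₂.IsFlat) : (C₁.tensor C₂).IsFlat :=
  fun _ _ γ' γ hγ' hγ w =>
    InteriorChart.tensorTriv_transport_eq_of_apply_transport_eq (C₁.e _) (C₁.e _) (C₂.e _) (C₂.e _) _
      (h₁ γ' γ (fun t => (le_max_left _ _).trans (hγ' t)) hγ) (h₂ γ' γ (fun t => (le_max_right _ _).trans (hγ' t)) hγ) w

end Tensor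

variable {D : VHSData S k} {L : PolarizedLimitMixedHodgeStructure V k} {C : D.PunctureChart σ L}

/-- `cast` keeps flatness. [cite: CattaniDeligneKaplan1995, (2.4) (p. 488)] -/
theorem IsFlat.cast (hC : C.IsFlat) (h : k = k') : (C.cast h).IsFlat := by
  subst h
  exact hC

/-- Tate twists keep flatness. [cite: CattaniDeligneKaplan1995, (2.4) (p. 488)] [cite: DeligneHodgeII1971, 2.1.14] -/
theorem IsFlat.tateTwist (hC : C.IsFlat) (j : ℤ) : (C.tateTwist j).IsFlat :=
  hC

/-- **The puncture chart of the dual variation is flat when the chart is** (`e_z^∨ = e_z ∘ θ⁻¹`). [cite: CattaniDeligneKaplan1995, (2.4) (p. 488)]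
[cite: Deligne1982HodgeCycles, I Prop. 3.6 (proof)] -/
theorem IsFlat.dual (hC : C.IsFlat) : C.dual.IsFlat := by
  intro z z' γ' γ hγ' hγ φ
  show D.dualTriv (σ z') (C.e z') (D.dual.V.transport (Path.Homotopic.Quotient.mk γ) φ) = D.dualTriv (σ z) (C.e z) φ
  rw [D.dualTriv_apply, D.dualTriv_apply, D.ofDualFiber_dual_transport, hC γ' γ hγ' hγ]

end PunctureChart

/-- **The charts of a constant variation are flat** (all transports are the identity, all trivializations the identity).
[cite: Schmid1973, §2] [cite: CattaniDeligneKaplan1995, (2.4) (p. 488)] -/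
theorem InteriorChart.isFlat_const (S : Type) [TopologicalSpace S] {M : Type} [AddCommGroup M] [Module.Finite ℤ M] [Module.Free ℤ M] {V : Type}
    [AddCommGroup V] [Module ℚ V] [FiniteDimensional ℚ V] {ι : M →ₗ[ℤ] V} (hι : IsBaseChange ℚ ι) {n : ℤ} {H : HodgeStructure V n}
    (Q : H.Polarization) (ψ : OpenPartialHomeomorph S ℂ) (hψ : IsPreconnected ψ.target) : (InteriorChart.const S hι Q ψ hψ).IsFlat :=
  fun _ _ _ _ _ _ _ => rfl

/-- The puncture charts of a constant variation are flat. [cite: CattaniDeligneKaplan1995, (2.4) (p. 488)] -/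
theorem PunctureChart.isFlat_const (S : Type) [TopologicalSpace S] {M : Type} [AddCommGroup M] [Module.Finite ℤ M] [Module.Free ℤ M] {V : Type}
    [AddCommGroup V] [Module ℚ V] [FiniteDimensional ℚ V] {ι : M →ₗ[ℤ] V} (hι : IsBaseChange ℚ ι) {n : ℤ} {H : HodgeStructure V n}
    (Q : H.Polarization) (σ : ℂ → S) : (PunctureChart.const S hι Q σ).IsFlat :=
  fun _ _ _ _ _ _ _ => rfl

/-- The interior charts of `ℤ_S(j)` are flat. [cite: CattaniDeligneKaplan1995, (2.4) (p. 488)] -/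
theorem InteriorChart.isFlat_tate (S : Type) [TopologicalSpace S] (j : ℤ) (ψ : OpenPartialHomeomorph S ℂ) (hψ : IsPreconnected ψ.target) :
    (InteriorChart.tate S j ψ hψ).IsFlat :=
  InteriorChart.isFlat_const S _ _ ψ hψ

/-- The puncture charts of `ℤ_S(j)` are flat. [cite: CattaniDeligneKaplan1995, (2.4) (p. 488)] -/
theorem PunctureChart.isFlat_tate (S : Type) [TopologicalSpace S] (j : ℤ) (σ : ℂ → S) : (PunctureChart.tate S j σ).IsFlat :=
  PunctureChart.isFlat_const S _ _ σ

/-- The interior charts of `ℤ_S` are flat. [cite: CattaniDeligneKaplan1995, (2.4) (p. 488)] -/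
theorem InteriorChart.isFlat_unit (S : Type) [TopologicalSpace S] (ψ : OpenPartialHomeomorph S ℂ) (hψ : IsPreconnected ψ.target) :
    (InteriorChart.unit S ψ hψ).IsFlat :=
  (InteriorChart.isFlat_tate S 0 ψ hψ).cast _

/-- The puncture charts of `ℤ_S` are flat. [cite: CattaniDeligneKaplan1995, (2.4) (p. 488)] -/
theorem PunctureChart.isFlat_unit (S : Type) [TopologicalSpace S] (σ : ℂ → S) : (PunctureChart.unit S σ).IsFlat :=
  (PunctureChart.isFlat_tate S 0 σ).cast _

end Constructions

/-! ## §3 Flat-charted variations -/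

variable {α ι : Type*} (ψ : α → OpenPartialHomeomorph S ℂ) (σ : ι → ℂ → S)

/-- **`D` is FLAT-CHARTED** with respect to the coordinate discs `ψ a` and the ends `σ i`: on every disc a FLAT interior local period chart, along
every end a FLAT local period chart at the puncture (reference data existential in `Type`) — `IsCharted` with the flatness of the frames recorded,
the standing local hypotheses of Cattani–Deligne–Kaplan's Corollary 1.3 over a curve. [cite: CattaniDeligneKaplan1995, §1 (pp. 483–484), Cor. 1.3,
(2.4) (p. 488), 2.7 (p. 489)] [cite: Schmid1973, §2 and (4.9)–(4.12) (cite only)] -/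
structure IsFlatCharted (D : VHSData S k) : Prop where
  /-- a flat interior chart on each coordinate disc -/
  interior : ∀ a, ∃ (V : Type) (_ : AddCommGroup V) (_ : Module ℚ V) (_ : FiniteDimensional ℚ V) (H₀ : HodgeStructure V k)
    (P₀ : H₀.Polarization) (C : D.InteriorChart (ψ a) P₀), C.IsFlat
  /-- a flat puncture chart along each end -/
  puncture : ∀ i, ∃ (V : Type) (_ : AddCommGroup V) (_ : Module ℚ V) (_ : FiniteDimensional ℚ V) (L : PolarizedLimitMixedHodgeStructure V k)
    (C : D.PunctureChart (σ i) L), C.IsFlat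

namespace IsFlatCharted

variable {ψ σ}

/-- A flat-charted variation is charted. [cite: CattaniDeligneKaplan1995, §1 (pp. 483–484)] -/
theorem isCharted {D : VHSData S k} (h : D.IsFlatCharted ψ σ) : D.IsCharted ψ σ := by
  refine ⟨fun a => ?_, fun i => ?_⟩
  · obtain ⟨V, _, _, _, H₀, P₀, C, -⟩ := h.interior a
    exact ⟨V, inferInstance, inferInstance, inferInstance, H₀, P₀, ⟨C⟩⟩
  · obtain ⟨V, _, _, _, L, C, -⟩ := h.puncture i
    exact ⟨V, inferInstance, inferInstance, inferInstance, L, ⟨C⟩⟩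

/-- Flat charts with a common reference space give `IsFlatCharted`. [cite: CattaniDeligneKaplan1995, §1 (pp. 483–484)] -/
theorem of_charts {D : VHSData S k} {V : Type} [AddCommGroup V] [Module ℚ V] [FiniteDimensional ℚ V] {H₀ : α → HodgeStructure V k}
    {P₀ : ∀ a, (H₀ a).Polarization} (Ci : ∀ a, D.InteriorChart (ψ a) (P₀ a)) (hCi : ∀ a, (Ci a).IsFlat)
    {L : ι → PolarizedLimitMixedHodgeStructure V k} (Cp : ∀ i, D.PunctureChart (σ i) (L i)) (hCp : ∀ i, (Cp i).IsFlat) : D.IsFlatCharted ψ σ :=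
  ⟨fun a => ⟨V, inferInstance, inferInstance, inferInstance, H₀ a, P₀ a, Ci a, hCi a⟩,
    fun i => ⟨V, inferInstance, inferInstance, inferInstance, L i, Cp i, hCp i⟩⟩

/-- **`D₁, D₂` flat-charted ⟹ `D₁ ⊗ D₂` flat-charted.** [cite: Schmid1973, §2] [cite: CattaniDeligneKaplan1995, §1 (pp. 483–484)] -/
theorem tensor {D₁ : VHSData S k₁} {D₂ : VHSData S k₂} (h₁ : D₁.IsFlatCharted ψ σ) (h₂ : D₂.IsFlatCharted ψ σ) :
    (D₁.tensor D₂).IsFlatCharted ψ σ := by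
  haveI : HodgeTensorFacts.{0, 0} := hodgeTensorFacts_holds
  refine ⟨fun a => ?_, fun i => ?_⟩
  · obtain ⟨V₁, _, _, _, H₁, P₁, C₁, hC₁⟩ := h₁.interior a
    obtain ⟨V₂, _, _, _, H₂, P₂, C₂, hC₂⟩ := h₂.interior a
    exact ⟨V₁ ⊗[ℚ] V₂, inferInstance, inferInstance, inferInstance, H₁.tensor H₂, P₁.tensor P₂, C₁.tensor C₂, hC₁.tensor hC₂⟩
  · obtain ⟨V₁, _, _, _, L₁, C₁, hC₁⟩ := h₁.puncture i
    obtain ⟨V₂, _, _, _, L₂, C₂, hC₂⟩ := h₂.puncture i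
    exact ⟨V₁ ⊗[ℚ] V₂, inferInstance, inferInstance, inferInstance, L₁.tensor L₂, C₁.tensor C₂, hC₁.tensor hC₂⟩

/-- `D` flat-charted ⟹ `D.cast h` flat-charted. [cite: CattaniDeligneKaplan1995, §1 (pp. 483–484)] -/
theorem cast {D : VHSData S k} (h : D.IsFlatCharted ψ σ) (e : k = k') : (D.cast e).IsFlatCharted ψ σ := by
  refine ⟨fun a => ?_, fun i => ?_⟩
  · obtain ⟨V, _, _, _, H₀, P₀, C, hC⟩ := h.interior a
    exact ⟨V, inferInstance, inferInstance, inferInstance, _, P₀.cast e, C.cast e, hC.cast e⟩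
  · obtain ⟨V, _, _, _, L, C, hC⟩ := h.puncture i
    exact ⟨V, inferInstance, inferInstance, inferInstance, L.cast e, C.cast e, hC.cast e⟩

/-- `D` flat-charted ⟹ `D(j)` flat-charted. [cite: DeligneHodgeII1971, 2.1.14] [cite: CattaniDeligneKaplan1995, §1 (pp. 483–484)] -/
theorem tateTwist {D : VHSData S k} (h : D.IsFlatCharted ψ σ) (j : ℤ) : (D.tateTwist j).IsFlatCharted ψ σ := by
  refine ⟨fun a => ?_, fun i => ?_⟩
  · obtain ⟨V, _, _, _, H₀, P₀, C, hC⟩ := h.interior a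
    exact ⟨V, inferInstance, inferInstance, inferInstance, _, P₀.tateTwist j, C.tateTwist j, hC.tateTwist j⟩
  · obtain ⟨V, _, _, _, L, C, hC⟩ := h.puncture i
    exact ⟨V, inferInstance, inferInstance, inferInstance, L.tateTwist j, C.tateTwist j, hC.tateTwist j⟩

/-- **`D` flat-charted ⟹ `D^∨` flat-charted.** [cite: Schmid1973, §2] [cite: Deligne1982HodgeCycles, I Prop. 3.6 (proof)] -/
theorem dual {D : VHSData S k} (h : D.IsFlatCharted ψ σ) : D.dual.IsFlatCharted ψ σ := by
  refine ⟨fun a => ?_, fun i => ?_⟩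
  · obtain ⟨V, _, _, _, H₀, P₀, C, hC⟩ := h.interior a
    exact ⟨V, inferInstance, inferInstance, inferInstance, _, _, C.dual, hC.dual⟩
  · obtain ⟨V, _, _, _, L, C, hC⟩ := h.puncture i
    exact ⟨V, inferInstance, inferInstance, inferInstance, _, C.dual, hC.dual⟩

/-- **Constant variations are flat-charted** on discs with preconnected targets. [cite: CattaniDeligneKaplan1995, (2.4), 2.7 (pp. 488–489)] -/
theorem const (hψ : ∀ a, IsPreconnected (ψ a).target) {M : Type} [AddCommGroup M] [Module.Finite ℤ M] [Module.Free ℤ M] {V : Type}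
    [AddCommGroup V] [Module ℚ V] [FiniteDimensional ℚ V] {ι' : M →ₗ[ℤ] V} (hι : IsBaseChange ℚ ι') {n : ℤ} {H : HodgeStructure V n}
    (Q : H.Polarization) : (VHSData.const S hι Q).IsFlatCharted ψ σ :=
  of_charts (fun a => InteriorChart.const S hι Q (ψ a) (hψ a)) (fun a => InteriorChart.isFlat_const S hι Q (ψ a) (hψ a))
    (fun i => PunctureChart.const S hι Q (σ i)) fun i => PunctureChart.isFlat_const S hι Q (σ i)

/-- The Tate variation `ℤ_S(j)` is flat-charted. [cite: DeligneHodgeII1971, 2.1.13] [cite: CattaniDeligneKaplan1995, (2.4) (p. 488)] -/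
theorem tate (hψ : ∀ a, IsPreconnected (ψ a).target) (j : ℤ) : (VHSData.tate S j).IsFlatCharted ψ σ :=
  of_charts (fun a => InteriorChart.tate S j (ψ a) (hψ a)) (fun a => InteriorChart.isFlat_tate S j (ψ a) (hψ a))
    (fun i => PunctureChart.tate S j (σ i)) fun i => PunctureChart.isFlat_tate S j (σ i)

/-- The unit variation `ℤ_S` is flat-charted. [cite: DeligneHodgeII1971, 2.1.13] [cite: CattaniDeligneKaplan1995, (2.4) (p. 488)] -/
theorem unit (hψ : ∀ a, IsPreconnected (ψ a).target) : (VHSData.unit S).IsFlatCharted ψ σ :=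
  of_charts (fun a => InteriorChart.unit S (ψ a) (hψ a)) (fun a => InteriorChart.isFlat_unit S (ψ a) (hψ a))
    (fun i => PunctureChart.unit S (σ i)) fun i => PunctureChart.isFlat_unit S (σ i)

/-- **`D` flat-charted ⟹ every tensor power `D^{⊗m}` flat-charted** (`D^{⊗0} = ℤ_S`, `D^{⊗(m+1)} = D^{⊗m} ⊗ D`). [cite: CattaniDeligneKaplan1995, §1 (pp. 483–484)]
[cite: Deligne1982HodgeCycles, I §3, 3.1–3.4] -/
theorem tensorPow {D : VHSData S k} (h : D.IsFlatCharted ψ σ) (hψ : ∀ a, IsPreconnected (ψ a).target) :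
    ∀ m : ℕ, (D.tensorPow m).IsFlatCharted ψ σ
  | 0 => (unit hψ).cast _
  | m + 1 => ((tensorPow h hψ m).tensor h).cast _

/-- **`D` flat-charted ⟹ every mixed tensor space `T^{a,b}D = D^{⊗a} ⊗ (D^∨)^{⊗b}` flat-charted.** [cite: CattaniDeligneKaplan1995, §1 (pp. 483–484)]
[cite: Deligne1982HodgeCycles, I §3, 3.1–3.4] -/
theorem tensorSpace {D : VHSData S k} (h : D.IsFlatCharted ψ σ) (hψ : ∀ a, IsPreconnected (ψ a).target) (a b : ℕ) :
    (D.tensorSpace a b).IsFlatCharted ψ σ :=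
  (h.tensorPow hψ a).tensor (h.dual.tensorPow hψ b)

/-- **`D₁, D₂` flat-charted ⟹ `Hom(D₁, D₂) = D₁^∨ ⊗ D₂` flat-charted** (in particular `End(D)`). [cite: CattaniDeligneKaplan1995, §1 (p. 484)] [cite: Deligne1970, I.1] -/
theorem hom {D₁ : VHSData S k₁} {D₂ : VHSData S k₂} (h₁ : D₁.IsFlatCharted ψ σ) (h₂ : D₂.IsFlatCharted ψ σ) :
    (D₁.hom D₂).IsFlatCharted ψ σ :=
  (h₁.dual.tensor h₂).cast _

end IsFlatCharted

/-! ## §4 The local dichotomies for the set «some determination of `u₀` is of type `(p, p)`» from flat bundled charts -/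

section Local

variable {D : VHSData S k} {V : Type u} [AddCommGroup V] [Module ℚ V] [FiniteDimensional ℚ V]

/-- **At every point of the disc of a FLAT interior chart, the set «some determination of `u₀` is of type `(p, p)`» is a neighbourhood of the
point or is avoided by a punctured neighbourhood of it** (`mem_nhds_or_eventually_not_mem_determinationLocus_at` on a bundled chart).
[cite: CattaniDeligneKaplan1995, Cor. 1.3 and §1 (p. 484)] [cite: FritzscheGrauert2002, Ch. I §8 (after Prop. 8.1, n = 1)] -/
theorem InteriorChart.IsFlat.mem_nhds_or_eventually_not_mem_determinationLocus {ψ : OpenPartialHomeomorph S ℂ} {H₀ : HodgeStructure V k}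
    {P₀ : H₀.Polarization} {C : D.InteriorChart ψ P₀} (hC : C.IsFlat) {p : ℤ} (hpk : p + p = k) {s₀ : S} (u₀ : D.VZ.fiber s₀) {x : S}
    (hx : x ∈ ψ.source) :
    {t : S | ∃ γ : Path.Homotopic.Quotient s₀ t, D.IsHodgeAt t p (D.VZ.transport γ u₀)} ∈ 𝓝 x ∨
      ∀ᶠ y in 𝓝[≠] x, y ∉ {t : S | ∃ γ : Path.Homotopic.Quotient s₀ t, D.IsHodgeAt t p (D.VZ.transport γ u₀)} :=
  D.mem_nhds_or_eventually_not_mem_determinationLocus_at hpk u₀ ψ C.isPreconnected_target C.e H₀ P₀ C.h C.analyticOnNhd_h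
    (fun c hc => C.map_F_eq c hc p) C.Λ C.fg_Λ C.e_toRat_mem C.κ_pos (fun _ hc x => C.mul_hodgeNorm_ofRat_le hc x)
    (fun _ hc _ hc' => hC.exists_transport_eq hc hc') hx

/-- **Along the end of a FLAT puncture chart (unipotent monodromy), with `σ` continuous on `{Im ≥ A₀}`, the set «some determination of `u₀` is of type
`(p, p)`» contains `σ{Im ≥ A}` or avoids it, for some `A ≥ A₀`** (`forall_mem_determinationLocus_or_forall_not_mem_near_puncture` on a bundled chart).
[cite: CattaniDeligneKaplan1995, Cor. 1.3 (p. 484), Thm. 1.5 (p. 485), Thm. 2.5 (p. 488)] [cite: Schmid1973, §2] -/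
theorem PunctureChart.IsFlat.exists_forall_mem_determinationLocus_or_forall_not_mem_of_continuousOn {σ : ℂ → S}
    {L : PolarizedLimitMixedHodgeStructure V k} {C : D.PunctureChart σ L} (hC : C.IsFlat) (hσ : ContinuousOn σ {w : ℂ | C.A₀ ≤ w.im}) {p : ℤ}
    (hpk : p + p = k) {s₀ : S} (u₀ : D.VZ.fiber s₀) :
    ∃ A : ℝ, C.A₀ ≤ A ∧
      ((∀ z : ℂ, A ≤ z.im → ∃ γ : Path.Homotopic.Quotient s₀ (σ z), D.IsHodgeAt (σ z) p (D.VZ.transport γ u₀)) ∨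
        (∀ z : ℂ, A ≤ z.im → ¬ ∃ γ : Path.Homotopic.Quotient s₀ (σ z), D.IsHodgeAt (σ z) p (D.VZ.transport γ u₀))) :=
  D.forall_mem_determinationLocus_or_forall_not_mem_near_puncture L hpk u₀ C.Γ C.Γ_zero C.analyticAt_Γ C.Γ_mem C.Λ C.fg_Λ C.monodromy_mem σ
    C.e C.A₀ (fun z hz => C.map_F_eq z hz p) C.form_eq C.e_toRat_mem fun _ _ hz hz' => hC.exists_transport_eq hσ hz hz'

/-- **The same with `σ` continuous on an OPEN half-plane `{Im > A′}` only** (as furnished by a compactification, `continuousOn_end_lift`): raise the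
chart to height `max A₀ (A′ + 1)` first. [cite: CattaniDeligneKaplan1995, Cor. 1.3 (p. 484), Thm. 1.5 (p. 485), 2.3 (p. 487)] -/
theorem PunctureChart.IsFlat.exists_forall_mem_determinationLocus_or_forall_not_mem {σ : ℂ → S} {L : PolarizedLimitMixedHodgeStructure V k}
    {C : D.PunctureChart σ L} (hC : C.IsFlat) {A' : ℝ} (hσ : ContinuousOn σ {w : ℂ | A' < w.im}) {p : ℤ} (hpk : p + p = k) {s₀ : S}
    (u₀ : D.VZ.fiber s₀) :
    ∃ A : ℝ, C.A₀ ≤ A ∧ A' ≤ A ∧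
      ((∀ z : ℂ, A ≤ z.im → ∃ γ : Path.Homotopic.Quotient s₀ (σ z), D.IsHodgeAt (σ z) p (D.VZ.transport γ u₀)) ∨
        (∀ z : ℂ, A ≤ z.im → ¬ ∃ γ : Path.Homotopic.Quotient s₀ (σ z), D.IsHodgeAt (σ z) p (D.VZ.transport γ u₀))) := by
  have hle : C.A₀ ≤ max C.A₀ (A' + 1) := le_max_left _ _
  have hσ' : ContinuousOn σ {w : ℂ | (C.raise _ hle).A₀ ≤ w.im} :=
    hσ.mono fun w (hw : max C.A₀ (A' + 1) ≤ w.im) => lt_of_lt_of_le (lt_add_one A') ((le_max_right _ _).trans hw)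
  obtain ⟨A, hA, h⟩ := (hC.raise _ hle).exists_forall_mem_determinationLocus_or_forall_not_mem_of_continuousOn hσ' hpk u₀
  exact ⟨A, hle.trans hA, ((le_add_of_nonneg_right zero_le_one).trans (le_max_right _ _)).trans hA, h⟩

end Local

/-! ## §5 Corollary 1.3 (`r = 1`) for a flat-charted variation -/

namespace IsFlatCharted

variable {ψ σ}

/-- **CATTANI–DELIGNE–KAPLAN, COROLLARY 1.3 (`r = 1`) FOR A FLAT-CHARTED VARIATION.**  `S` preconnected and covered by the discs `ψ a`; along each end
`σ i` a height `A i` beyond which `σ i` is continuous, maps `{Im z > A′}` onto open sets, and off which a compact core remains.  For `p + p = k` and an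
integral vector `u₀ ∈ V_ℤ,s₀` («a section of `𝒱_ℤ` on a universal covering of `S`»): **the set of `t ∈ S` where SOME determination `γ · u₀`
(`γ : s₀ ⇝ t`) is of type `(p, p)` is ALL of `S` or FINITE** («an algebraic subvariety of `S`», `S` a curve).
[cite: CattaniDeligneKaplan1995, Cor. 1.3 (p. 484), Thm. 1.1, Thm. 1.5 and «Proof of 1.5 ⟹ 1.1» (p. 485)] [cite: Schmid1973, §2 (cite only)] [cite: FritzscheGrauert2002, Ch. I §8] -/
theorem determinationLocus_eq_univ_or_finite [PreconnectedSpace S] {D : VHSData S k} (h : D.IsFlatCharted ψ σ) {p : ℤ} (hpk : p + p = k)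
    {s₀ : S} (u₀ : D.VZ.fiber s₀) (hcov : ∀ x : S, ∃ a, x ∈ (ψ a).source) (A : ι → ℝ)
    (hopen : ∀ (i : ι) (A' : ℝ), A i ≤ A' → IsOpen (σ i '' {z : ℂ | A' < z.im}))
    (hcore : ∀ A' : ι → ℝ, (∀ i, A i ≤ A' i) → ∃ K₀ : Set S, IsCompact K₀ ∧ K₀ ∪ ⋃ i, σ i '' {z : ℂ | A' i < z.im} = univ)
    (hcont : ∀ i, ContinuousOn (σ i) {z : ℂ | A i < z.im}) :
    {t : S | ∃ γ : Path.Homotopic.Quotient s₀ t, D.IsHodgeAt t p (D.VZ.transport γ u₀)} = univ ∨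
      {t : S | ∃ γ : Path.Homotopic.Quotient s₀ t, D.IsHodgeAt t p (D.VZ.transport γ u₀)}.Finite := by
  set Z : Set S := {t : S | ∃ γ : Path.Homotopic.Quotient s₀ t, D.IsHodgeAt t p (D.VZ.transport γ u₀)} with hZ
  -- the heights at the punctures
  have hend : ∀ i, ∃ A' : ℝ, A i ≤ A' ∧ ((∀ z : ℂ, A' ≤ z.im → σ i z ∈ Z) ∨ (∀ z : ℂ, A' ≤ z.im → σ i z ∉ Z)) := fun i => by
    obtain ⟨V, _, _, _, L, C, hC⟩ := h.puncture i
    obtain ⟨A', -, hA', hdich⟩ := hC.exists_forall_mem_determinationLocus_or_forall_not_mem (hcont i) hpk u₀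
    exact ⟨A', hA', hdich⟩
  choose A' hA' hA using hend
  obtain ⟨K₀, hK₀, hcovK⟩ := hcore A' hA'
  refine Literature.Topology.eq_univ_or_finite_of_forall (fun x => ?_) hK₀ (E := fun i => σ i '' {z : ℂ | A' i < z.im})
    (fun i => hopen i (A' i) (hA' i)) (by rw [hcovK]; exact subset_univ _) fun i => ?_
  · obtain ⟨a, hx⟩ := hcov x
    obtain ⟨V, _, _, _, H₀, P₀, C, hC⟩ := h.interior a
    exact hC.mem_nhds_or_eventually_not_mem_determinationLocus hpk u₀ hx
  · rcases hA i with hall | hnone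
    · refine Or.inl ?_
      rintro _ ⟨z, hz, rfl⟩
      exact hall z (le_of_lt hz)
    · refine Or.inr (Set.disjoint_left.2 ?_)
      rintro _ ⟨z, hz, rfl⟩
      exact hnone z (le_of_lt hz)

variable {X : Type*} [TopologicalSpace X] [CompactSpace X]

/-- **COROLLARY 1.3 FOR A FLAT-CHARTED VARIATION OVER A PUNCTURED COMPACT CURVE**: the ends, the core AND the continuity of the end maps from a
compactification `j : S ↪ X` (`X` compact, `X ∖ j(S) ⊆ {pt i}`, disc charts `φ i` at the punctures containing the ball of radius `e^{−2πA_i}`,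
`j (σ i z) = (φ i)⁻¹(e^{2πiz})` beyond height `A i`). [cite: CattaniDeligneKaplan1995, Cor. 1.3 (p. 484), 2.3 (p. 487)] -/
theorem determinationLocus_eq_univ_or_finite_of_compactification [PreconnectedSpace S] {D : VHSData S k} (h : D.IsFlatCharted ψ σ) {p : ℤ}
    (hpk : p + p = k) {s₀ : S} (u₀ : D.VZ.fiber s₀) (hcov : ∀ x : S, ∃ a, x ∈ (ψ a).source) (A : ι → ℝ)
    {j : S → X} (hj : IsEmbedding j) (pt : ι → X) (hpS : ∀ i, pt i ∉ range j) (hcovX : ∀ x : X, x ∉ range j → ∃ i, x = pt i)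
    (φ : ι → OpenPartialHomeomorph X ℂ) (hp : ∀ i, pt i ∈ (φ i).source) (hφp : ∀ i, φ i (pt i) = 0)
    (hball : ∀ i, Metric.ball (0 : ℂ) (Real.exp (-(2 * Real.pi * A i))) ⊆ (φ i).target)
    (hσ : ∀ (i : ι) (z : ℂ), A i < z.im → j (σ i z) = (φ i).symm (Complex.exp (2 * Real.pi * Complex.I * z))) :
    {t : S | ∃ γ : Path.Homotopic.Quotient s₀ t, D.IsHodgeAt t p (D.VZ.transport γ u₀)} = univ ∨
      {t : S | ∃ γ : Path.Homotopic.Quotient s₀ t, D.IsHodgeAt t p (D.VZ.transport γ u₀)}.Finite :=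
  h.determinationLocus_eq_univ_or_finite hpk u₀ hcov A (Literature.Topology.isOpen_image_ends hj φ A hball σ hσ)
    (Literature.Topology.exists_isCompact_core hj pt hpS hcovX φ hp hφp A hball σ hσ) (continuousOn_end_lifts hj φ A hball σ hσ)

/-! ## §6 Corollary 1.3 for all the tensor constructions -/

/-- **COR. 1.3 FOR `D₁ ⊗ D₂`**: for flat-charted `D₁`, `D₂` (same discs and ends), `p + p = k₁ + k₂`, and an integral tensor `u₀ ∈ (V₁,ℤ ⊗ V₂,ℤ)_{s₀}`, the
set of points carrying SOME determination of `u₀` of type `(p, p)` is `S` or finite. [cite: CattaniDeligneKaplan1995, Cor. 1.3 (p. 484)] [cite: Schmid1973, §2] -/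
theorem determinationLocus_tensor_eq_univ_or_finite [PreconnectedSpace S] {D₁ : VHSData S k₁} {D₂ : VHSData S k₂} (h₁ : D₁.IsFlatCharted ψ σ)
    (h₂ : D₂.IsFlatCharted ψ σ) {p : ℤ} (hpk : p + p = k₁ + k₂) {s₀ : S} (u₀ : (D₁.tensor D₂).VZ.fiber s₀) (hcov : ∀ x : S, ∃ a, x ∈ (ψ a).source)
    (A : ι → ℝ) (hopen : ∀ (i : ι) (A' : ℝ), A i ≤ A' → IsOpen (σ i '' {z : ℂ | A' < z.im}))
    (hcore : ∀ A' : ι → ℝ, (∀ i, A i ≤ A' i) → ∃ K₀ : Set S, IsCompact K₀ ∧ K₀ ∪ ⋃ i, σ i '' {z : ℂ | A' i < z.im} = univ)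
    (hcont : ∀ i, ContinuousOn (σ i) {z : ℂ | A i < z.im}) :
    {t : S | ∃ γ : Path.Homotopic.Quotient s₀ t, (D₁.tensor D₂).IsHodgeAt t p ((D₁.tensor D₂).VZ.transport γ u₀)} = univ ∨
      {t : S | ∃ γ : Path.Homotopic.Quotient s₀ t, (D₁.tensor D₂).IsHodgeAt t p ((D₁.tensor D₂).VZ.transport γ u₀)}.Finite :=
  (h₁.tensor h₂).determinationLocus_eq_univ_or_finite hpk u₀ hcov A hopen hcore hcont

/-- **COR. 1.3 FOR THE DUAL VARIATION `D^∨`** (`p + p = −k`). [cite: CattaniDeligneKaplan1995, Cor. 1.3 (p. 484)] [cite: Deligne1982HodgeCycles, I Prop. 3.6] -/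
theorem determinationLocus_dual_eq_univ_or_finite [PreconnectedSpace S] {D : VHSData S k} (h : D.IsFlatCharted ψ σ) {p : ℤ} (hpk : p + p = -k)
    {s₀ : S} (u₀ : D.dual.VZ.fiber s₀) (hcov : ∀ x : S, ∃ a, x ∈ (ψ a).source) (A : ι → ℝ)
    (hopen : ∀ (i : ι) (A' : ℝ), A i ≤ A' → IsOpen (σ i '' {z : ℂ | A' < z.im}))
    (hcore : ∀ A' : ι → ℝ, (∀ i, A i ≤ A' i) → ∃ K₀ : Set S, IsCompact K₀ ∧ K₀ ∪ ⋃ i, σ i '' {z : ℂ | A' i < z.im} = univ)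
    (hcont : ∀ i, ContinuousOn (σ i) {z : ℂ | A i < z.im}) :
    {t : S | ∃ γ : Path.Homotopic.Quotient s₀ t, D.dual.IsHodgeAt t p (D.dual.VZ.transport γ u₀)} = univ ∨
      {t : S | ∃ γ : Path.Homotopic.Quotient s₀ t, D.dual.IsHodgeAt t p (D.dual.VZ.transport γ u₀)}.Finite :=
  h.dual.determinationLocus_eq_univ_or_finite hpk u₀ hcov A hopen hcore hcont

/-- **COR. 1.3 FOR THE TENSOR POWERS `D^{⊗m}`** (`p + p = m·k`). [cite: CattaniDeligneKaplan1995, Cor. 1.3 (p. 484)] [cite: Deligne1982HodgeCycles, I §3, 3.1–3.4] -/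
theorem determinationLocus_tensorPow_eq_univ_or_finite [PreconnectedSpace S] {D : VHSData S k} (h : D.IsFlatCharted ψ σ)
    (hψ : ∀ a, IsPreconnected (ψ a).target) (m : ℕ) {p : ℤ} (hpk : p + p = (m : ℤ) * k) {s₀ : S} (u₀ : (D.tensorPow m).VZ.fiber s₀)
    (hcov : ∀ x : S, ∃ a, x ∈ (ψ a).source) (A : ι → ℝ) (hopen : ∀ (i : ι) (A' : ℝ), A i ≤ A' → IsOpen (σ i '' {z : ℂ | A' < z.im}))
    (hcore : ∀ A' : ι → ℝ, (∀ i, A i ≤ A' i) → ∃ K₀ : Set S, IsCompact K₀ ∧ K₀ ∪ ⋃ i, σ i '' {z : ℂ | A' i < z.im} = univ)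
    (hcont : ∀ i, ContinuousOn (σ i) {z : ℂ | A i < z.im}) :
    {t : S | ∃ γ : Path.Homotopic.Quotient s₀ t, (D.tensorPow m).IsHodgeAt t p ((D.tensorPow m).VZ.transport γ u₀)} = univ ∨
      {t : S | ∃ γ : Path.Homotopic.Quotient s₀ t, (D.tensorPow m).IsHodgeAt t p ((D.tensorPow m).VZ.transport γ u₀)}.Finite :=
  (h.tensorPow hψ m).determinationLocus_eq_univ_or_finite hpk u₀ hcov A hopen hcore hcont

/-- **CATTANI–DELIGNE–KAPLAN, COROLLARY 1.3 FOR EVERY MIXED TENSOR SPACE `T^{a,b}D = D^{⊗a} ⊗ (D^∨)^{⊗b}` OF A FLAT-CHARTED VARIATION OVER A CURVE**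
(the multivalued tensorial Hodge loci): for `p + p = a·k + b·(−k)` and an integral tensor `u₀ ∈ T^{a,b}V_ℤ,s₀`, **the set of `t ∈ S` where SOME
determination `γ · u₀` is of type `(p, p)` is ALL of `S` or FINITE.** [cite: CattaniDeligneKaplan1995, Cor. 1.3 (p. 484), Thm. 1.5 and «Proof of 1.5 ⟹ 1.1» (p. 485)]
[cite: Deligne1982HodgeCycles, I §3, 3.1–3.4] [cite: KlinglerOtwinowskaUrbanik2023, §1.1 (context)] -/
theorem determinationLocus_tensorSpace_eq_univ_or_finite [PreconnectedSpace S] {D : VHSData S k} (h : D.IsFlatCharted ψ σ)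
    (hψ : ∀ a, IsPreconnected (ψ a).target) (a b : ℕ) {p : ℤ} (hpk : p + p = (a : ℤ) * k + (b : ℤ) * (-k)) {s₀ : S}
    (u₀ : (D.tensorSpace a b).VZ.fiber s₀) (hcov : ∀ x : S, ∃ a, x ∈ (ψ a).source) (A : ι → ℝ)
    (hopen : ∀ (i : ι) (A' : ℝ), A i ≤ A' → IsOpen (σ i '' {z : ℂ | A' < z.im}))
    (hcore : ∀ A' : ι → ℝ, (∀ i, A i ≤ A' i) → ∃ K₀ : Set S, IsCompact K₀ ∧ K₀ ∪ ⋃ i, σ i '' {z : ℂ | A' i < z.im} = univ)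
    (hcont : ∀ i, ContinuousOn (σ i) {z : ℂ | A i < z.im}) :
    {t : S | ∃ γ : Path.Homotopic.Quotient s₀ t, (D.tensorSpace a b).IsHodgeAt t p ((D.tensorSpace a b).VZ.transport γ u₀)} = univ ∨
      {t : S | ∃ γ : Path.Homotopic.Quotient s₀ t, (D.tensorSpace a b).IsHodgeAt t p ((D.tensorSpace a b).VZ.transport γ u₀)}.Finite :=
  (h.tensorSpace hψ a b).determinationLocus_eq_univ_or_finite hpk u₀ hcov A hopen hcore hcont

/-- **COR. 1.3 FOR THE MULTIVALUED MORPHISM LOCUS**: for flat-charted `D₁`, `D₂` and an integral element `u₀ ∈ Hom(V₁,ℤ, V₂,ℤ)_{s₀} = (V₁,ℤ^∨ ⊗ V₂,ℤ)_{s₀}`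
(`p + p = k₂ − k₁`; for `p = 0`, `k₁ = k₂`: a `ℤ`-linear map `V₁,ℤ,s₀ → V₂,ℤ,s₀` continued along paths), the set of `t ∈ S` where SOME determination of `u₀` is of
type `(p, p)` (a morphism of Hodge structures `V₁,t → V₂,t`) is `S` or finite; `D₁ = D₂`: multivalued extra endomorphisms.
[cite: CattaniDeligneKaplan1995, Cor. 1.3 and §1 (p. 484: «replacing `𝒱` by `𝒱 ⊗ 𝒱^*` or by `End 𝒱`»)] [cite: Deligne1970, I.1] -/
theorem determinationLocus_hom_eq_univ_or_finite [PreconnectedSpace S] {D₁ : VHSData S k₁} {D₂ : VHSData S k₂} (h₁ : D₁.IsFlatCharted ψ σ)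
    (h₂ : D₂.IsFlatCharted ψ σ) {p : ℤ} (hpk : p + p = k₂ - k₁) {s₀ : S} (u₀ : (D₁.hom D₂).VZ.fiber s₀) (hcov : ∀ x : S, ∃ a, x ∈ (ψ a).source)
    (A : ι → ℝ) (hopen : ∀ (i : ι) (A' : ℝ), A i ≤ A' → IsOpen (σ i '' {z : ℂ | A' < z.im}))
    (hcore : ∀ A' : ι → ℝ, (∀ i, A i ≤ A' i) → ∃ K₀ : Set S, IsCompact K₀ ∧ K₀ ∪ ⋃ i, σ i '' {z : ℂ | A' i < z.im} = univ)
    (hcont : ∀ i, ContinuousOn (σ i) {z : ℂ | A i < z.im}) :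
    {t : S | ∃ γ : Path.Homotopic.Quotient s₀ t, (D₁.hom D₂).IsHodgeAt t p ((D₁.hom D₂).VZ.transport γ u₀)} = univ ∨
      {t : S | ∃ γ : Path.Homotopic.Quotient s₀ t, (D₁.hom D₂).IsHodgeAt t p ((D₁.hom D₂).VZ.transport γ u₀)}.Finite :=
  (h₁.hom h₂).determinationLocus_eq_univ_or_finite hpk u₀ hcov A hopen hcore hcont

/-- **COR. 1.3 FOR EVERY `T^{a,b}D` OVER A PUNCTURED COMPACT CURVE** (topological hypotheses read off the compactification).
[cite: CattaniDeligneKaplan1995, Cor. 1.3 (p. 484), 2.3 (p. 487)] [cite: Deligne1982HodgeCycles, I §3, 3.1–3.4] -/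
theorem determinationLocus_tensorSpace_eq_univ_or_finite_of_compactification [PreconnectedSpace S] {D : VHSData S k} (h : D.IsFlatCharted ψ σ)
    (hψ : ∀ a, IsPreconnected (ψ a).target) (a b : ℕ) {p : ℤ} (hpk : p + p = (a : ℤ) * k + (b : ℤ) * (-k)) {s₀ : S}
    (u₀ : (D.tensorSpace a b).VZ.fiber s₀) (hcov : ∀ x : S, ∃ a, x ∈ (ψ a).source) (A : ι → ℝ)
    {j : S → X} (hj : IsEmbedding j) (pt : ι → X) (hpS : ∀ i, pt i ∉ range j) (hcovX : ∀ x : X, x ∉ range j → ∃ i, x = pt i)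
    (φ : ι → OpenPartialHomeomorph X ℂ) (hp : ∀ i, pt i ∈ (φ i).source) (hφp : ∀ i, φ i (pt i) = 0)
    (hball : ∀ i, Metric.ball (0 : ℂ) (Real.exp (-(2 * Real.pi * A i))) ⊆ (φ i).target)
    (hσ : ∀ (i : ι) (z : ℂ), A i < z.im → j (σ i z) = (φ i).symm (Complex.exp (2 * Real.pi * Complex.I * z))) :
    {t : S | ∃ γ : Path.Homotopic.Quotient s₀ t, (D.tensorSpace a b).IsHodgeAt t p ((D.tensorSpace a b).VZ.transport γ u₀)} = univ ∨
      {t : S | ∃ γ : Path.Homotopic.Quotient s₀ t, (D.tensorSpace a b).IsHodgeAt t p ((D.tensorSpace a b).VZ.transport γ u₀)}.Finite :=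
  (h.tensorSpace hψ a b).determinationLocus_eq_univ_or_finite_of_compactification hpk u₀ hcov A hj pt hpS hcovX φ hp hφp hball hσ

/-- **COR. 1.3 FOR THE MULTIVALUED MORPHISM LOCUS OVER A PUNCTURED COMPACT CURVE.** [cite: CattaniDeligneKaplan1995, Cor. 1.3 and §1 (p. 484), 2.3 (p. 487)]
[cite: Deligne1970, I.1] -/
theorem determinationLocus_hom_eq_univ_or_finite_of_compactification [PreconnectedSpace S] {D₁ : VHSData S k₁} {D₂ : VHSData S k₂}
    (h₁ : D₁.IsFlatCharted ψ σ) (h₂ : D₂.IsFlatCharted ψ σ) {p : ℤ} (hpk : p + p = k₂ - k₁) {s₀ : S} (u₀ : (D₁.hom D₂).VZ.fiber s₀)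
    (hcov : ∀ x : S, ∃ a, x ∈ (ψ a).source) (A : ι → ℝ)
    {j : S → X} (hj : IsEmbedding j) (pt : ι → X) (hpS : ∀ i, pt i ∉ range j) (hcovX : ∀ x : X, x ∉ range j → ∃ i, x = pt i)
    (φ : ι → OpenPartialHomeomorph X ℂ) (hp : ∀ i, pt i ∈ (φ i).source) (hφp : ∀ i, φ i (pt i) = 0)
    (hball : ∀ i, Metric.ball (0 : ℂ) (Real.exp (-(2 * Real.pi * A i))) ⊆ (φ i).target)
    (hσ : ∀ (i : ι) (z : ℂ), A i < z.im → j (σ i z) = (φ i).symm (Complex.exp (2 * Real.pi * Complex.I * z))) :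
    {t : S | ∃ γ : Path.Homotopic.Quotient s₀ t, (D₁.hom D₂).IsHodgeAt t p ((D₁.hom D₂).VZ.transport γ u₀)} = univ ∨
      {t : S | ∃ γ : Path.Homotopic.Quotient s₀ t, (D₁.hom D₂).IsHodgeAt t p ((D₁.hom D₂).VZ.transport γ u₀)}.Finite :=
  (h₁.hom h₂).determinationLocus_eq_univ_or_finite_of_compactification hpk u₀ hcov A hj pt hpS hcovX φ hp hφp hball hσ

end IsFlatCharted

end Motives.VHSData

end Literature.AlgebraicGeometry

end
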